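import Mathlib

/-!
# Stub `stub_tangencySets` of the crux `LevelOneGL2Designs` (stmt-MatrixMultiplication-14080) —
wall-breaker axis 5/12, *parabola lifts over finite fields*: the thickening lemma, exposed graphs,
and the stub versus the prime-field saving conjecture

The stub asks for strong representative systems (induced point–line matchings) of size
`c · p^{3/2}` in `AG(2,p)` for unboundedly many PRIMES `p`.  Every *lift* construction on record —
Szőnyi's quadratic-residue (Paley) lift, the pencil/conic families, the Hunter–Pohoata–Verstraëte–
Zhang lift of Ruzsa's square-difference-free sets (`IM(2,p) ≫ p^{1.2334}`, the 2026 record for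
primes), and the interval ("exposed graph") thickenings studied on this axis — is ONE mechanism:

* `tangencySet_of_thickening` (**the thickening lemma**): base flags `(x_i, y_i)` with slopes `m_i`
  and a fibre set `E ⊆ 𝔽_p`; if the defects `y_i − y_j − m_j (x_i − x_j)` of distinct base flags
  avoid the difference set `E − E`, the vertical translates `(x_i, y_i + e)`, `e ∈ E`, each with the
  translated line, form an affine tangency set of size `|T|·|E|` (Paley: base = parabola, `E` = a
  Paley coclique; HPVZ/Ruzsa: base = short parabola arc, `E` = integer square-difference-free set;
  this axis: base = an `H`-exposed graph, `E = [0,H)`).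
* `tangencySet_of_exposedGraph`: the interval case — a graph `x ↦ φ x` over `X ⊆ 𝔽_p` with slopes
  `θ` such that every other graph point is at CYCLIC vertical distance `≥ H` from the line through
  `(x₀, φ x₀)` of slope `θ x₀` thickens to a tangency set of size `|X|·H`.
* `card_filter_slope_mul_le`, `card_mul_le_card_image_slope_mul` (**slope budget**): columns of an
  exposed graph with a common slope number `≤ p/H`, so weight `≤ p · #slopes`; weight `c·p^{3/2}`
  needs `≥ c√p` distinct slopes.
* (companion file `…StubTangencySetsExposedReduction.lean`, `stub_tangencySets_of_exposedGraphs`):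
  hence exposed graphs of weight `|X|·H ≥ c·p^{3/2}` for unboundedly many primes give the stub
  VERBATIM (constant `c/2`, through `TangencyHermitian.stub_tangencySets_of_affineTangencySets`).
  This is the residual of the axis.
Literature status (see AXIS.md): the stub is the failure, along a subsequence of primes, of the
prime-field saving conjecture of Hunter–Pohoata–Verstraëte–Zhang (arXiv:2601.19879, Conj. 10.2:
`IM(2,q) ≤ q^{3/2−c}` for all large primes `q`; formalised by the axis-10 seat as
`stub_tangencySets_false_of_primeSaving`), which by HPVZ §10 implies power savings for Paley
cliques and for the Furstenberg–Sárközy problem; the 2026 record for primes is `p^{1.2334}`.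

No new definitions; everything is elementary.  References: Hunter–Pohoata–Verstraëte–Zhang 2026
(bib `HunterPohoataVerstraeteZhang2026`), Props. 2.1, 2.3 and Conj. 10.2; Szőnyi 1992
(bib `Szonyi1992LargeMinimalBlockingSets`); Illés–Szőnyi–Wettl 1991.
-/

-- justification: the tree path `MatrixMultiplication/MatrixMultiplication` (summit = problem) makes every
-- declaration name contain a duplicated namespace segment, which this linter would flag.
set_option linter.dupNamespace false

open Finset Matrix

namespace Summit.MatrixMultiplication.MatrixMultiplication.Theorems.LevelOneGL2Designs.TangencyThickening

variable {p : ℕ} [hp : Fact p.Prime]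

/-- **The thickening lemma** (common skeleton of the Paley lift, the Ruzsa/HPVZ lift and the
interval thickenings).  Base flags indexed by `T`: points `(x i, y i)` with non-vertical tangent
direction `(1, m i)`; fibre set `E ⊆ 𝔽_p`.  If a relation `y i + e − (y j + e') = m j · (x i − x j)`
("the translate `(x i, y i + e)` lies on the translated line of the flag `(j, e')`") forces
`i = j ∧ e = e'`, then the `|T|·|E|` translates form an affine tangency set: every point carries a
line (normal vector `(m j, −1) ≠ 0`) meeting the set only in that point. [elementary] -/
theorem tangencySet_of_thickening {ι : Type*} (T : Finset ι) (x y m : ι → ZMod p)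
    (E : Finset (ZMod p))
    (h : ∀ i ∈ T, ∀ j ∈ T, ∀ e ∈ E, ∀ e' ∈ E,
      y i + e - (y j + e') = m j * (x i - x j) → i = j ∧ e = e') :
    ∃ V : Finset (Fin 2 → ZMod p), V.card = T.card * E.card ∧
      ∀ v ∈ V, ∃ u : Fin 2 → ZMod p, u ≠ 0 ∧ ∀ w ∈ V, u ⬝ᵥ w = u ⬝ᵥ v → w = v := by
  classical
  let P : ι × ZMod p → (Fin 2 → ZMod p) := fun q => ![x q.1, y q.1 + q.2]
  have hinj : Set.InjOn P ↑(T ×ˢ E) := by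
    rintro ⟨i, e⟩ hi ⟨j, e'⟩ hj hP
    rw [coe_product, Set.mem_prod, mem_coe, mem_coe] at hi hj
    have h0 : x i = x j := by
      have := congrFun hP 0
      simpa [P] using this
    have h1 : y i + e = y j + e' := by
      have := congrFun hP 1
      simpa [P] using this
    obtain ⟨rfl, rfl⟩ := h i hi.1 j hj.1 e hi.2 e' hj.2
      (by rw [h1, h0, sub_self, sub_self, mul_zero])
    rfl
  refine ⟨(T ×ˢ E).image P, by rw [card_image_of_injOn hinj, card_product], ?_⟩
  simp only [mem_image, mem_product]
  rintro v ⟨⟨j, e'⟩, ⟨hj, he'⟩, rfl⟩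
  refine ⟨![m j, -1], ?_, ?_⟩
  · intro h0
    have := congrFun h0 1
    simp at this
  · rintro w ⟨⟨i, e⟩, ⟨hi, he⟩, rfl⟩ hdot
    simp only [P, vec2_dotProduct, Matrix.cons_val_zero, Matrix.cons_val_one,
      Matrix.cons_val_fin_one] at hdot
    obtain ⟨rfl, rfl⟩ := h i hi j hj e he e' he' (by linear_combination -hdot)
    rfl

/-- **Exposed graphs thicken to tangency sets** (the interval case of the thickening lemma, the
parabola-lift mechanism with an archimedean fibre).  Let `φ, θ : 𝔽_p → 𝔽_p`, `X ⊆ 𝔽_p`, `H ≤ p`,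
and suppose the graph is `H`-EXPOSED on `X`: for `x ≠ x₀` in `X` the defect
`φ x − φ x₀ − θ x₀ (x − x₀)` has representative in `[H, p − H]` (cyclic vertical distance `≥ H`
from the line of slope `θ x₀` through `(x₀, φ x₀)`).  Then the points `(x, φ x + j)`, `x ∈ X`,
`0 ≤ j < H`, each with the line of slope `θ x` through it, form an affine tangency set of size
`|X|·H`. [elementary] -/
theorem tangencySet_of_exposedGraph (X : Finset (ZMod p)) (φ θ : ZMod p → ZMod p) (H : ℕ)
    (hH : H ≤ p)
    (hexp : ∀ x₀ ∈ X, ∀ x ∈ X, x ≠ x₀ →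
      H ≤ (φ x - φ x₀ - θ x₀ * (x - x₀)).val ∧ (φ x - φ x₀ - θ x₀ * (x - x₀)).val + H ≤ p) :
    ∃ V : Finset (Fin 2 → ZMod p), V.card = X.card * H ∧
      ∀ v ∈ V, ∃ u : Fin 2 → ZMod p, u ≠ 0 ∧ ∀ w ∈ V, u ⬝ᵥ w = u ⬝ᵥ v → w = v := by
  classical
  set E : Finset (ZMod p) := (range H).image (Nat.cast : ℕ → ZMod p) with hE
  have hcast : Set.InjOn (Nat.cast : ℕ → ZMod p) ↑(range H) := by
    intro a ha b hb hab
    rw [coe_range, Set.mem_Iio] at ha hb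
    have hab' := (ZMod.natCast_eq_natCast_iff' a b p).1 hab
    rwa [Nat.mod_eq_of_lt (by omega), Nat.mod_eq_of_lt (by omega)] at hab'
  have hEcard : E.card = H := by rw [hE, card_image_of_injOn hcast, card_range]
  have key : ∀ i ∈ X, ∀ j ∈ X, ∀ e ∈ E, ∀ e' ∈ E,
      φ i + e - (φ j + e') = θ j * (id i - id j) → i = j ∧ e = e' := by
    intro i hi j hj e he e' he' hrel
    rw [hE, mem_image] at he he'
    obtain ⟨a, ha, rfl⟩ := he
    obtain ⟨b, hb, rfl⟩ := he'
    rw [mem_range] at ha hb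
    simp only [id] at hrel
    by_cases hij : i = j
    · subst hij
      exact ⟨rfl, by linear_combination hrel⟩
    · exfalso
      obtain ⟨h1, h2⟩ := hexp j hj i hi hij
      have hΔ : φ i - φ j - θ j * (i - j) = (b : ZMod p) - a := by linear_combination hrel
      rw [hΔ] at h1 h2
      rcases le_or_gt a b with hab | hab
      · -- `b - a < H`, contradicting `H ≤ val (b - a)`
        have hval : ((b : ZMod p) - a).val = b - a := by
          rw [← Nat.cast_sub hab, ZMod.val_natCast, Nat.mod_eq_of_lt (by omega)]
        omega
      · -- `val (b - a) = p - (a - b) > p - H`, contradicting `val (b - a) + H ≤ p`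
        have hval : ((b : ZMod p) - a).val = p - (a - b) := by
          have hrepr : (b : ZMod p) - a = ((p - (a - b) : ℕ) : ZMod p) := by
            rw [Nat.cast_sub (by omega : a - b ≤ p), Nat.cast_sub hab.le, ZMod.natCast_self]
            ring
          rw [hrepr, ZMod.val_natCast, Nat.mod_eq_of_lt (by omega)]
        omega
  obtain ⟨V, hV, htan⟩ := tangencySet_of_thickening X id φ θ E key
  refine ⟨V, ?_, htan⟩
  rw [hV, hEcard]

/-- **Slope budget of an exposed graph.**  In an `H`-exposed graph the columns `x ∈ X` with a
COMMON slope `θ x = t` number at most `p / H`: their intercepts `φ x − t·x` are pairwise at cyclic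
distance `≥ H`, so `(x, j) ↦ φ x − t·x + j` (`j < H`) is injective into `𝔽_p`.  Consequently an
exposed graph of weight `|X|·H ≥ c·p^{3/2}` uses at least `c·√p` distinct slopes — the formal reason
why every construction with `O(1)` "nice" slopes (integer parts, digit/two-scale models, see AXIS.md)
stalls at weight `O(p)`, while the unital of `AG(2,q²)` uses all `q²` slopes. [elementary] -/
theorem card_filter_slope_mul_le (X : Finset (ZMod p)) (φ θ : ZMod p → ZMod p) (H : ℕ)
    (hH : H ≤ p)
    (hexp : ∀ x₀ ∈ X, ∀ x ∈ X, x ≠ x₀ →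
      H ≤ (φ x - φ x₀ - θ x₀ * (x - x₀)).val ∧ (φ x - φ x₀ - θ x₀ * (x - x₀)).val + H ≤ p)
    (t : ZMod p) :
    (X.filter fun x => θ x = t).card * H ≤ p := by
  classical
  let g : ZMod p × ℕ → ZMod p := fun q => φ q.1 - t * q.1 + (q.2 : ZMod p)
  have hinj : Set.InjOn g ↑((X.filter fun x => θ x = t) ×ˢ range H) := by
    rintro ⟨x, a⟩ hx ⟨x', b⟩ hx' hg
    rw [coe_product, Set.mem_prod, mem_coe, mem_coe, mem_filter, mem_range] at hx hx'
    obtain ⟨⟨hxX, hθx⟩, ha⟩ := hx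
    obtain ⟨⟨hx'X, -⟩, hb⟩ := hx'
    simp only [g] at hg
    by_cases hxx : x = x'
    · subst hxx
      have hab : (a : ZMod p) = b := by linear_combination hg
      have hab' := (ZMod.natCast_eq_natCast_iff' a b p).1 hab
      rw [Nat.mod_eq_of_lt (by omega), Nat.mod_eq_of_lt (by omega)] at hab'
      rw [hab']
    · exfalso
      obtain ⟨h1, h2⟩ := hexp x hxX x' hx'X (Ne.symm hxx)
      rw [hθx] at h1 h2
      have hΔ : φ x' - φ x - t * (x' - x) = (a : ZMod p) - b := by linear_combination -hg
      rw [hΔ] at h1 h2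
      rcases le_or_gt b a with hab | hab
      · have hval : ((a : ZMod p) - b).val = a - b := by
          rw [← Nat.cast_sub hab, ZMod.val_natCast, Nat.mod_eq_of_lt (by omega)]
        omega
      · have hval : ((a : ZMod p) - b).val = p - (b - a) := by
          have hrepr : (a : ZMod p) - b = ((p - (b - a) : ℕ) : ZMod p) := by
            rw [Nat.cast_sub (by omega : b - a ≤ p), Nat.cast_sub hab.le, ZMod.natCast_self]
            ring
          rw [hrepr, ZMod.val_natCast, Nat.mod_eq_of_lt (by omega)]
        omega
  have hle := card_le_card_of_injOn g (fun q _ => mem_coe.2 (mem_univ (g q))) hinj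
  rwa [card_product, card_range, card_univ, ZMod.card] at hle

/-- **Few slopes, small weight.**  The weight of an `H`-exposed graph is at most `p` times the
number of distinct slopes it uses (`card_filter_slope_mul_le` summed over the slope values).
[elementary] -/
theorem card_mul_le_card_image_slope_mul (X : Finset (ZMod p)) (φ θ : ZMod p → ZMod p) (H : ℕ)
    (hH : H ≤ p)
    (hexp : ∀ x₀ ∈ X, ∀ x ∈ X, x ≠ x₀ →
      H ≤ (φ x - φ x₀ - θ x₀ * (x - x₀)).val ∧ (φ x - φ x₀ - θ x₀ * (x - x₀)).val + H ≤ p) :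
    X.card * H ≤ (X.image θ).card * p := by
  classical
  rw [card_eq_sum_card_image θ X, sum_mul, ← smul_eq_mul, ← sum_const]
  exact sum_le_sum fun t _ => card_filter_slope_mul_le X φ θ H hH hexp t


/-! ## Dirichlet kills parallelograms: affine graphs over a progression of columns

`pred_mul_lt_of_multiples_far`, `pred_mul_lt_of_exposed_affine_progression`: if `t, 2t, …, (n−1)t`
are all cyclically `H`-far from `0` then `(n−1)H < p`; hence an exposed graph that is affine on a
progression of `n` columns has `(n−1)H < p` — boxes, digit models and generalized progressions
stall at weight `O(p)` (appended 2026-08-16, same seat). -/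

/-- **Far multiples (pigeonhole form of Dirichlet's approximation theorem).**  If the multiples
`t, 2t, …, (n−1)t ∈ 𝔽_p` all have representative in `[H, p − H]` (cyclic norm `≥ H`), then
`(n − 1)·H < p`: bucket the representatives of `0, t, …, (n−1)t` into `⌈p/H⌉` intervals of length
`H`; two in one bucket differ by a multiple `i·t`, `1 ≤ i ≤ n − 1`, of cyclic norm `< H`.
[folklore] -/
theorem pred_mul_lt_of_multiples_far (t : ZMod p) (n H : ℕ)
    (h : ∀ j : ℕ, 1 ≤ j → j < n → H ≤ ((j : ZMod p) * t).val ∧ ((j : ZMod p) * t).val + H ≤ p) :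
    (n - 1) * H < p := by
  classical
  have hp0 : 0 < p := hp.out.pos
  by_contra hcon
  push Not at hcon
  have hH : 0 < H := by
    rcases Nat.eq_zero_or_pos H with h0 | h0
    · rw [h0, mul_zero] at hcon
      omega
    · exact h0
  -- bucket `j ↦ ⌊val (j t) / H⌋`
  let f : ℕ → ℕ := fun j => ((j : ZMod p) * t).val / H
  have hmaps : ∀ j ∈ range n, f j ∈ range ((p - 1) / H + 1) := by
    intro j _
    rw [mem_range]
    have : ((j : ZMod p) * t).val ≤ p - 1 := Nat.le_sub_one_of_lt (ZMod.val_lt _)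
    exact Nat.lt_succ_of_le (Nat.div_le_div_right this)
  have hcard : (range ((p - 1) / H + 1)).card < (range n).card := by
    rw [card_range, card_range]
    have h1 : (p - 1) / H * H ≤ p - 1 := Nat.div_mul_le_self _ _
    have h2 : (p - 1) / H < n - 1 := by
      by_contra h3
      push Not at h3
      have : (n - 1) * H ≤ (p - 1) / H * H := Nat.mul_le_mul_right _ h3
      omega
    exact Nat.add_lt_of_lt_sub h2
  obtain ⟨j, hj, j', hj', hne, hfeq⟩ := exists_ne_map_eq_of_card_lt_of_maps_to hcard hmaps
  rw [mem_range] at hj hj'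
  -- without loss of generality `j < j'`
  wlog hlt : j < j' generalizing j j'
  · exact this j' hj' j hj hne.symm hfeq.symm (lt_of_le_of_ne (not_lt.1 hlt) hne.symm)
  set a := ((j : ZMod p) * t).val with ha
  set b := ((j' : ZMod p) * t).val with hb
  have hab : a / H = b / H := hfeq
  have e1 := Nat.div_add_mod a H
  have e2 := Nat.div_add_mod b H
  have m1 := Nat.mod_lt a hH
  have m2 := Nat.mod_lt b hH
  rw [hab] at e1
  have hbp : b < p := ZMod.val_lt _
  have hap : a < p := ZMod.val_lt _
  -- the multiple `(j' - j) t = j' t - j t`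
  set i := j' - j with hi
  obtain ⟨hfar1, hfar2⟩ := h i (by omega) (by omega)
  have hit : ((i : ZMod p) * t) = (b : ZMod p) - (a : ZMod p) := by
    rw [hb, ha, ZMod.natCast_zmod_val, ZMod.natCast_zmod_val, hi, Nat.cast_sub hlt.le]
    ring
  rcases le_or_gt a b with hle | hgt
  · have hval : ((i : ZMod p) * t).val = b - a := by
      rw [hit, ← Nat.cast_sub hle, ZMod.val_natCast, Nat.mod_eq_of_lt (by omega)]
    omega
  · have hval : ((i : ZMod p) * t).val = p - (a - b) := by
      have hrepr : (b : ZMod p) - a = ((p - (a - b) : ℕ) : ZMod p) := by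
        rw [Nat.cast_sub (by omega : a - b ≤ p), Nat.cast_sub hgt.le, ZMod.natCast_self]
        ring
      rw [hit, hrepr, ZMod.val_natCast, Nat.mod_eq_of_lt (by omega)]
    omega

/-- **Parallelograms have weight `< p + H`.**  If an exposed graph is AFFINE (`φ x = λ x + μ`) on
an arithmetic progression of columns `a, a + d, …, a + (n−1)d` (with arbitrary slopes `θ`), then
`(n − 1)·H < p`: its thickening, a sheared box, has weight `n·H < p + H ≤ 2p`.  The exposure of the
first column already says that the multiples of `(λ − θ a)·d` are far from `0`
(`pred_mul_lt_of_multiples_far`).  So the interval lift needs a base graph that is nowhere a long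
affine progression — the naive "box / digit / generalized-progression" bases die here, by
Dirichlet's approximation theorem, at weight `O(p)` instead of `p^{3/2}`. [elementary] -/
theorem pred_mul_lt_of_exposed_affine_progression (a d lam mu : ZMod p) (θ : ZMod p → ZMod p)
    (n H : ℕ)
    (hexp : ∀ k₀ : ℕ, k₀ < n → ∀ k : ℕ, k < n → k ≠ k₀ →
      H ≤ (lam * (a + k * d) + mu - (lam * (a + k₀ * d) + mu)
            - θ (a + k₀ * d) * ((a + k * d) - (a + k₀ * d))).val ∧
        (lam * (a + k * d) + mu - (lam * (a + k₀ * d) + mu)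
            - θ (a + k₀ * d) * ((a + k * d) - (a + k₀ * d))).val + H ≤ p) :
    (n - 1) * H < p := by
  rcases Nat.eq_zero_or_pos n with hn | hn
  · rw [hn]
    simpa using hp.out.pos
  apply pred_mul_lt_of_multiples_far ((lam - θ a) * d) n H
  intro j hj1 hjn
  obtain ⟨h1, h2⟩ := hexp 0 hn j hjn (by omega)
  have e : lam * (a + (j : ℕ) * d) + mu - (lam * (a + ((0 : ℕ) : ZMod p) * d) + mu)
      - θ (a + ((0 : ℕ) : ZMod p) * d) * ((a + (j : ℕ) * d) - (a + ((0 : ℕ) : ZMod p) * d))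
      = (j : ZMod p) * ((lam - θ a) * d) := by
    rw [Nat.cast_zero, zero_mul, add_zero]
    ring
  rw [e] at h1 h2
  exact ⟨h1, h2⟩

end Summit.MatrixMultiplication.MatrixMultiplication.Theorems.LevelOneGL2Designs.TangencyThickening
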